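import Summits.Ventures.CertifiedManyBodySolver.Theses.TcThermcert1
import HarnessLib

/-!
# Theorems/TcThermcert1ThermalStiffnessCeilingU8b10_of_split.lean — the gen-1 GLUE item of route «hubbard-tc-thermcert-1» (`Theses/TcThermcert1.lean`, rev 1), PROVED

Route `route-Ventures-TcThermcert1` (cell `pub/hubbard-tc`, rung MO-S3-thermcert-1; director-hubbard D-0154 (1) «THERMAL CERTIFICATES») was
revised (rev 1, 2026-08-29, planner hub-tc-therm-plan-1 under director-hubbard g18's β·t = 8 re-anchor ruling) by a GLUED SPLIT of its crux K1
`ThermalStiffnessCeilingU8b10_le_1o8` (the single-temperature sequence-robust uniform flux-stiffness ceiling `1/8` at `β·t = 10`, `(U, n, t′) = (8, 7/8, 0)`)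
into two children: K1′ `ThermalStiffnessCeilingU8b8_le_7o44` (the same leaf at `β·t = 8`, level `7/44`) and K1W `ThermalStiffnessCeilingU8b10_of_b8`
(window transport `β·t = 8 → 10`: the K1′ leaf implies the K1 leaf), glued back to K1 by the support item
`ThermalStiffnessCeilingU8b10_of_split := ThermalStiffnessCeilingU8b8_le_7o44 → ThermalStiffnessCeilingU8b10_of_b8 → ThermalStiffnessCeilingU8b10_le_1o8`.
This file proves that glue: it is modus ponens (`Function.eval`), pure logic, provable now.

HONEST FRAMING: this moves NOTHING about K1′, K1W, K1 or K2 (all OPEN: a certified `T > 0` current–current word is the missing object); the route's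
conclusions are one-sided CEILINGS on a Kosterlitz–Thouless temperature under the thermal KT dictionary (hypotheses); a ceiling never asserts
superconductivity; NO lower bound on `T_c` is claimed; no number of record moves; no summit statement is proved here.
Seat hubbard-thermal-eng-4 g3 (idle producer taking the glue per director-hubbard g18, tc INBOX l.2178 (ii)); item stmt-Ventures-24562.
-/

namespace Summit.Ventures.CertifiedManyBodySolver.Theses.TcThermcert1

/-- **The gen-1 glue of route «hubbard-tc-thermcert-1»**: K1′ → (K1′ → K1) → K1, i.e.
`ThermalStiffnessCeilingU8b8_le_7o44 → ThermalStiffnessCeilingU8b10_of_b8 → ThermalStiffnessCeilingU8b10_le_1o8` — modus ponens: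
the window-transport child applied to the `β·t = 8` child is the parent crux K1 verbatim. -/
theorem ThermalStiffnessCeilingU8b10_of_split_holds : ThermalStiffnessCeilingU8b10_of_split := by
  unfold ThermalStiffnessCeilingU8b10_of_split
  exact fun h w => w h

/-- The same glue as a bare term (`Function.eval`-shape), for callers who prefer it unapplied to `unfold`. -/
theorem ThermalStiffnessCeilingU8b10_of_split_holds' : ThermalStiffnessCeilingU8b10_of_split := fun h w => w h

end Summit.Ventures.CertifiedManyBodySolver.Theses.TcThermcert1
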